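import Literature.Computability.Complexity.GateEliminationCase54
import Literature.Computability.Complexity.GateEliminationAssignQuad
import Literature.Computability.Complexity.GateEliminationDoomedSharp

/-!
# Gate elimination: the circuit side of the quadratic substitution (Case 5.4.1.4 of Li–Yang)

Li–Yang §4.1, Case 5.4.1.4: "we can perform a quadratic substitution `z ← ((x ⊕ c₁) ∧ (y ⊕ c₂)) ⊕ c₃`
for appropriate constants, such that the output of `D` is a constant `b` insensitive to the
inputs, which trivializes `E`. Then we normalize the circuit … Replace `D` by the constant `b`,
which would not increase the potential." Here `G` is the ∧-type gate of the configuration of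
Case 5 (reading the `2`-variables `x`, `y`), `D` the ⊕-type gate reading `G` and the unprotected
variable `u` (the paper's `z`), read only by `D`. This file PROVES the circuit side of the
substitution: the constants (`quadEqOf`), the new source (`RdqSource.assignQuad` of the tree), the
circuit with the wires out of `D` replaced by the constant and `D` deleted (`quadElim`), that it is
fair and computes `f` on the new source, and its accounting (`G` stops being troubled, `u` stops
being influential, one more quadratic equation): `μ' ≤ μ(C, ∅, R) - 1 - α_I - α_φ + α_Q`.

## References

* J. Li, T. Yang, *3.1n − o(n) circuit lower bounds for explicit functions*, STOC 2022;
  ECCC TR21-023, §2.4 (quadratic substitution), §4.1 (Case 5.4.1.4).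
-/

namespace Literature.Computability.Complexity

open Finset

/-- `finTwoEquiv` turns products into conjunctions. [folklore] -/
theorem finTwoEquiv_mul (a b : ZMod 2) : finTwoEquiv (a * b) = (finTwoEquiv a && finTwoEquiv b) := by
  revert a b; decide

namespace Semicircuit

variable {n : ℕ} {C : Semicircuit n} {f : (Fin n → ZMod 2) → Bool} {R : RdqSource n} {d : ℕ}
  {αφ αI αQ : ℝ} {G : Fin C.m} {x y : Fin n} {B C' D : Fin C.m} {aX aB aC aD : Fin 2}

section Quad

variable (hF : C.Fair) (hC : C.ComputesRestr f R) (hS : C.Standing R) (hcfg : C.Case5Config G x y B C' D aX aB aC aD)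

/-- Re-gating an acyclic gate by replacing one of its wires with a constant is admissible. [folklore] -/
theorem regateOK_constWire {Q : Fin C.m} (hQ : Q ∉ C.xorPart) (a₀ : Fin 2) (c : Bool) :
    C.RegateOK Q (C.op Q) (fun a => if a = a₀ then .const c else C.arg Q a) := by
  refine ⟨fun h => absurd h hQ, fun _ a k hk hkK ρ hρ => ?_⟩
  change (if a = a₀ then Node.const c else C.arg Q a) = .gate k at hk
  by_cases ha : a = a₀
  · rw [if_pos ha] at hk; cases hk
  · rw [if_neg ha] at hk; exact hρ Q hQ a k hk hkK

include hF hC hS hcfg in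
/-- **The circuit side of the quadratic substitution** (Case 5.4.1.4 of Li–Yang): `D` (⊕-type, not
∧-type; reading the ∧-type `G` of the configuration of Case 5 and the unprotected variable `u`,
read only by `D`) is semantically the constant `kE` on the new source
`R' = R[u := ((x ⊕ c₁) ∧ (y ⊕ c₂)) ⊕ c₃]` for suitable constants; the two readers `E` (at `aE`),
`E'` (at `aE'`) of `D` are re-gated to read the constant `kE`, and `D` is deleted. The result is
fair, computes `f` on `R'`, has no troubled gate that was not troubled (`G` included: it becomes a
`0`-gate), and `μ' ≤ μ(C, ∅, R) - 1 - α_I - α_φ + α_Q`. [cite: LiYang2022, §2.4, §4.1 (Case 5.4.1.4)] -/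
theorem quadratic_step (hφ : 0 ≤ αφ) (hI : 0 ≤ αI)
    {E E' : Fin C.m} {aE aE' : Fin 2} {u : Fin n} (hDn : ¬ IsAndOp (C.op D)) (hIu : C.arg D aD.rev = .var u)
    (hup : ¬ R.Protected u) (hu1 : C.fanout (.var u) = 1) (hD2 : C.fanout (.gate D) = 2)
    (hEK : E ∉ C.xorPart) (hED : C.arg E aE = .gate D) (hE'D : C.arg E' aE' = .gate D) (hEE' : E ≠ E') (kE : Bool) :
    ∃ (C₃ : Semicircuit n) (R' : RdqSource n) (ι : Fin C₃.m → Fin C.m),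
      C₃.Fair ∧ C₃.ComputesRestr f R' ∧ R'.dim + 1 = R.dim ∧ C₃.m + 1 = C.m ∧ Function.Injective ι ∧
      (∀ k, ι k ≠ D) ∧ (∀ k, k ≠ D → ∃ k', ι k' = k) ∧
      -- wires: the two readers read the constant `kE` at their `D`-position, all other wires are kept
      (∀ k' a, (ι k' = E ∧ a = aE) ∨ (ι k' = E' ∧ a = aE') → C₃.arg k' a = .const kE) ∧
      (∀ k' a, ¬ ((ι k' = E ∧ a = aE) ∨ (ι k' = E' ∧ a = aE')) → ∀ i, C₃.arg k' a = .var i ↔ C.arg (ι k') a = .var i) ∧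
      (∀ k' a, ¬ ((ι k' = E ∧ a = aE) ∨ (ι k' = E' ∧ a = aE')) → ∀ k'', C₃.arg k' a = .gate k'' ↔ C.arg (ι k') a = .gate (ι k'')) ∧
      (∀ k', C₃.op k' = C.op (ι k')) ∧ (∀ k', C₃.out = .gate k' ↔ C.out = .gate (ι k')) ∧
      (∀ i, i ≠ u → C₃.fanout (.var i) = C.fanout (.var i)) ∧
      (∀ k', ι k' ≠ G → C₃.fanout (.gate k') = C.fanout (.gate (ι k'))) ∧
      (∀ k', ι k' = G → C₃.fanout (.gate k') = 0) ∧
      (∀ i, R'.Free i ↔ R.Free i ∧ i ≠ u) ∧ (∀ i, R'.Protected i ↔ R.Protected i ∨ i = x ∨ i = y) ∧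
      R'.quadCount = R.quadCount + 1 ∧
      (∀ k', C₃.Troubled k' → C.Troubled (ι k') ∧ ι k' ≠ G) ∧
      C₃.measure αφ αI αQ ∅ R' ≤ C.measure αφ αI αQ ∅ R - 1 - αI - αφ + αQ := by
  classical
  have hN := hS.normalized.1
  have hGK := hcfg.G_not_mem
  have hDK : D ∉ C.xorPart := fun hDK => hGK (C.mem_of_arg_eq D hDK aD G hcfg.arg_D)
  have hE'K : E' ∉ C.xorPart := fun h => hDK (C.mem_of_arg_eq E' h aE' D hE'D)
  have hDout : C.out ≠ .gate D := out_ne_of_read_bYacyclic hS hEK ⟨aE, hED⟩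
  have hED' : E ≠ D := fun h => by rw [h] at hED; exact C.arg_ne_self_of_not_mem hDK _ hED
  have hE'D' : E' ≠ D := fun h => by rw [h] at hE'D; exact C.arg_ne_self_of_not_mem hDK _ hE'D
  have hDG : D ≠ G := hcfg.D_ne_G
  have hEG : E ≠ G := by
    intro h; rw [h] at hED
    rcases fin2_eq_or_eq_rev aX aE with e' | e'
    · rw [e', hcfg.arg_G_x] at hED; cases hED
    · rw [e', hcfg.arg_G_y] at hED; cases hED
  have hE'G : E' ≠ G := by
    intro h; rw [h] at hE'D
    rcases fin2_eq_or_eq_rev aX aE' with e' | e'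
    · rw [e', hcfg.arg_G_x] at hE'D; cases hE'D
    · rw [e', hcfg.arg_G_y] at hE'D; cases hE'D
  have hux : u ≠ x := fun h => case5_D_not_x hS hcfg aD.rev (by rw [hIu, h])
  have huy : u ≠ y := fun h => case5_D_not_y hS hcfg aD.rev (by rw [hIu, h])
  have hu : R.Free u := free_of_reads hC hIu
  have hx : R.Free x := case5_free_x hC hcfg
  have hxp : ¬ R.Protected x := case5_unprot_x hS hcfg
  have hy : R.Free y := free_of_reads hC hcfg.arg_G_y
  have hyp : ¬ R.Protected y := case5_unprot_y hS hcfg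
  -- `D` is read once by `E`, once by `E'`, and by nobody else
  have hE1D : ∀ a, C.arg E a = .gate D → a = aE := by
    intro a h
    rcases fin2_eq_or_eq_rev aE a with e' | e'
    · exact e'
    · exfalso
      have e2 : ∀ a', C.arg E a' = .gate D := fun a' => by
        rcases fin2_eq_or_eq_rev aE a' with h' | h'
        · rw [h']; exact hED
        · rw [h', ← e']; exact h
      exact hN.arg_zero_ne_arg_one E (by rw [e2 0, e2 1])
  have hE'1D : ∀ a, C.arg E' a = .gate D → a = aE' := by
    intro a h
    rcases fin2_eq_or_eq_rev aE' a with e' | e'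
    · exact e'
    · exfalso
      have e2 : ∀ a', C.arg E' a' = .gate D := fun a' => by
        rcases fin2_eq_or_eq_rev aE' a' with h' | h'
        · rw [h']; exact hE'D
        · rw [h', ← e']; exact h
      exact hN.arg_zero_ne_arg_one E' (by rw [e2 0, e2 1])
  have honlyD : ∀ k a, C.arg k a = .gate D → k = E ∨ k = E' := by
    intro k a h
    by_contra hno
    rw [not_or] at hno
    have := three_le_fanout hED hE'D h hEE' (fun h' => hno.1 h'.symm) (fun h' => hno.2 h'.symm)
    omega
  -- the constants
  obtain ⟨g₁, g₂, g₃, hopG⟩ := hcfg.and_G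
  obtain ⟨dD, hdD⟩ : IsXorOp (C.op D) := C.isXorOp_of_isAffineOp hS.nonDegenerate ((isAndOp_or_isAffineOp _).resolve_left hDn)
  let cx : Bool := if aX = 0 then g₁ else g₂
  let cy : Bool := if aX = 0 then g₂ else g₁
  let c₃ : Bool := (g₃ ^^ dD) ^^ kE
  let e : QuadEq n := ⟨x, boolToZMod2 cx, y, boolToZMod2 cy, boolToZMod2 c₃⟩
  let R' := R.assignQuad u e hu hup hx hxp hy hyp hcfg.x_ne_y hux huy
  -- the circuit: re-gate `E`, `E'`, delete `D`
  let argsE : Fin 2 → Node n C.m := fun a => if a = aE then .const kE else C.arg E a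
  let C₁ := C.regate E (C.op E) argsE (C.regateOK_constWire hEK aE kE)
  have hE'K₁ : E' ∉ C₁.xorPart := hE'K
  let argsE' : Fin 2 → Node n C.m := fun a => if a = aE' then .const kE else C₁.arg E' a
  let C₂ := C₁.regate E' (C₁.op E') argsE' (C₁.regateOK_constWire hE'K₁ aE' kE)
  have hF₁ : C₁.Fair := hF.regate_acyclic hEK
  have hF₂ : C₂.Fair := hF₁.regate_acyclic hE'K₁
  -- wires of `C₂`
  have harg₂ : ∀ k a, C₂.arg k a = if k = E' then argsE' a else if k = E then argsE a else C.arg k a := by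
    intro k a
    show (if k = E' then argsE' a else (if k = E then argsE a else C.arg k a)) = _
    rfl
  have hargE₂ : ∀ a, C₂.arg E a = argsE a := by
    intro a; rw [harg₂, if_neg hEE', if_pos rfl]
  have hargE'₂ : ∀ a, C₂.arg E' a = argsE' a := by
    intro a; rw [harg₂, if_pos rfl]
  have hargsE'eq : ∀ a, argsE' a = if a = aE' then .const kE else C.arg E' a := by
    intro a
    show (if a = aE' then Node.const kE else (if E' = E then argsE a else C.arg E' a)) = _
    rw [if_neg (show ¬ (E' = E) from fun h => hEE' h.symm)]
  have harg₂_of_ne : ∀ {k} (hkE : k ≠ E) (hkE' : k ≠ E') (a), C₂.arg k a = C.arg k a := by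
    intro k hkE hkE' a; rw [harg₂, if_neg hkE', if_neg hkE]
  have hop₂ : ∀ k, C₂.op k = C.op k := by
    intro k
    show (if k = E' then C₁.op E' else C₁.op k) = _
    have h1 : ∀ k', C₁.op k' = C.op k' := fun k' => by
      show (if k' = E then C.op E else C.op k') = _; split_ifs with h <;> [rw [h]; rfl]
    split_ifs with h <;> [rw [h1, h]; exact h1 k]
  -- `D` has no reader in `C₂`
  have h0₂ : ∀ k a, C₂.arg k a ≠ .gate D := by
    intro k a h
    rw [harg₂] at h
    by_cases hkE' : k = E'
    · rw [if_pos hkE', hargsE'eq] at h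
      by_cases ha : a = aE'
      · rw [if_pos ha] at h; cases h
      · rw [if_neg ha] at h; exact ha (hE'1D a h)
    · rw [if_neg hkE'] at h
      by_cases hkE : k = E
      · rw [if_pos hkE] at h
        change (if a = aE then Node.const kE else C.arg E a) = .gate D at h
        by_cases ha : a = aE
        · rw [if_pos ha] at h; cases h
        · rw [if_neg ha] at h; exact ha (hE1D a h)
      · rw [if_neg hkE] at h
        rcases honlyD k a h with h' | h'
        · exact hkE h'
        · exact hkE' h'
  let ε := C₂.skipEquiv D
  let C₃ := C₂.removeGate D ε
  have hF₃ : C₃.Fair := hF₂.removeGate ε h0₂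
  let ι : Fin C₃.m → Fin C.m := fun k => (ε k : Fin C.m)
  have hιinj : Function.Injective ι := fun a b h => ε.injective (Subtype.ext h)
  have hιD : ∀ k, ι k ≠ D := fun k => (ε k).2
  have hιsurj : ∀ k, k ≠ D → ∃ k', ι k' = k := fun k hk => ⟨ε.symm ⟨k, hk⟩, by simp [ι, ε]⟩
  -- wires of `C₃`
  have harg₃ : ∀ k' a, C₃.arg k' a = (C₂.arg (ι k') a).skip D ε := fun _ _ => rfl
  have hconst₃ : ∀ k' a, (ι k' = E ∧ a = aE) ∨ (ι k' = E' ∧ a = aE') → C₃.arg k' a = .const kE := by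
    rintro k' a (⟨h1, h2⟩ | ⟨h1, h2⟩)
    · rw [harg₃, h1, h2, hargE₂]; show (if aE = aE then Node.const kE else C.arg E aE).skip D ε = _; rw [if_pos rfl]; rfl
    · rw [harg₃, h1, h2, hargE'₂, hargsE'eq, if_pos rfl]; rfl
  have hother₂ : ∀ k' a, ¬ ((ι k' = E ∧ a = aE) ∨ (ι k' = E' ∧ a = aE')) → C₂.arg (ι k') a = C.arg (ι k') a := by
    intro k' a hno
    rw [harg₂]
    by_cases h1 : ι k' = E'
    · rw [if_pos h1, hargsE'eq, if_neg (fun h2 => hno (Or.inr ⟨h1, h2⟩)), h1]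
    · rw [if_neg h1]
      by_cases h2 : ι k' = E
      · rw [if_pos h2, h2]
        show (if a = aE then Node.const kE else C.arg E a) = _
        rw [if_neg (fun h3 => hno (Or.inl ⟨h2, h3⟩))]
      · rw [if_neg h2]
  have hvar₃ : ∀ k' a, ¬ ((ι k' = E ∧ a = aE) ∨ (ι k' = E' ∧ a = aE')) → ∀ i, C₃.arg k' a = .var i ↔ C.arg (ι k') a = .var i := by
    intro k' a hno i; rw [harg₃, hother₂ k' a hno, Node.skip_eq_var_iff]
  have hgate₃ : ∀ k' a, ¬ ((ι k' = E ∧ a = aE) ∨ (ι k' = E' ∧ a = aE')) → ∀ k'', C₃.arg k' a = .gate k'' ↔ C.arg (ι k') a = .gate (ι k'') := by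
    intro k' a hno k''; rw [harg₃, hother₂ k' a hno, Node.skip_eq_gate_iff]
  have hop₃ : ∀ k', C₃.op k' = C.op (ι k') := fun k' => hop₂ _
  have hout₃ : ∀ k', C₃.out = .gate k' ↔ C.out = .gate (ι k') := by
    intro k'; show (C.out).skip D ε = .gate k' ↔ _; rw [Node.skip_eq_gate_iff]
  -- out-degrees of variables are unchanged by the two re-gatings
  have hfilt : ∀ (i : Fin n), (univ.filter fun a : Fin 2 => argsE a = .var i) = univ.filter fun a : Fin 2 => C.arg E a = .var i := by
    intro i; ext a; simp only [mem_filter, mem_univ, true_and]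
    show (if a = aE then Node.const kE else C.arg E a) = .var i ↔ _
    by_cases ha : a = aE
    · rw [if_pos ha, ha, hED]; exact ⟨(fun h => by cases h), fun h => by cases h⟩
    · rw [if_neg ha]
  have hfilt' : ∀ (i : Fin n), (univ.filter fun a : Fin 2 => argsE' a = .var i) = univ.filter fun a : Fin 2 => C₁.arg E' a = .var i := by
    intro i; ext a; simp only [mem_filter, mem_univ, true_and]
    rw [hargsE'eq]
    have : C₁.arg E' a = C.arg E' a := by show (if E' = E then argsE a else C.arg E' a) = _; rw [if_neg (show ¬ (E' = E) from fun h => hEE' h.symm)]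
    rw [this]
    by_cases ha : a = aE'
    · rw [if_pos ha, ha, hE'D]; exact ⟨(fun h => by cases h), fun h => by cases h⟩
    · rw [if_neg ha]
  have hfv₂ : ∀ i, C₂.fanout (.var i) = C.fanout (.var i) := by
    intro i
    have h1 := C.fanout_regate_add E (C.op E) argsE (C.regateOK_constWire hEK aE kE) (.var i)
    have h2 := C₁.fanout_regate_add E' (C₁.op E') argsE' (C₁.regateOK_constWire hE'K₁ aE' kE) (.var i)
    rw [hfilt] at h1; rw [hfilt'] at h2
    change C₂.fanout (.var i) + _ = C₁.fanout (.var i) + _ at h2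
    change C₁.fanout (.var i) + _ = C.fanout (.var i) + _ at h1
    omega
  -- gate out-degrees: unchanged except for `D`
  have hfiltg : ∀ (k : Fin C.m), k ≠ D → (univ.filter fun a : Fin 2 => argsE a = .gate k) = univ.filter fun a : Fin 2 => C.arg E a = .gate k := by
    intro k hk; ext a; simp only [mem_filter, mem_univ, true_and]
    show (if a = aE then Node.const kE else C.arg E a) = .gate k ↔ _
    by_cases ha : a = aE
    · rw [if_pos ha, ha, hED]; exact ⟨(fun h => by cases h), fun h => by cases h; exact absurd rfl hk⟩
    · rw [if_neg ha]
  have hfiltg' : ∀ (k : Fin C.m), k ≠ D → (univ.filter fun a : Fin 2 => argsE' a = .gate k) = univ.filter fun a : Fin 2 => C₁.arg E' a = .gate k := by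
    intro k hk; ext a; simp only [mem_filter, mem_univ, true_and]
    rw [hargsE'eq]
    have : C₁.arg E' a = C.arg E' a := by show (if E' = E then argsE a else C.arg E' a) = _; rw [if_neg (show ¬ (E' = E) from fun h => hEE' h.symm)]
    rw [this]
    by_cases ha : a = aE'
    · rw [if_pos ha, ha, hE'D]; exact ⟨(fun h => by cases h), fun h => by cases h; exact absurd rfl hk⟩
    · rw [if_neg ha]
  have hfg₂ : ∀ k, k ≠ D → C₂.fanout (.gate k) = C.fanout (.gate k) := by
    intro k hk
    have h1 := C.fanout_regate_add E (C.op E) argsE (C.regateOK_constWire hEK aE kE) (.gate k)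
    have h2 := C₁.fanout_regate_add E' (C₁.op E') argsE' (C₁.regateOK_constWire hE'K₁ aE' kE) (.gate k)
    rw [hfiltg k hk] at h1; rw [hfiltg' k hk] at h2
    change C₂.fanout (.gate k) + _ = C₁.fanout (.gate k) + _ at h2
    change C₁.fanout (.gate k) + _ = C.fanout (.gate k) + _ at h1
    omega
  have hDwires : ∀ a, C₂.arg D a = C.arg D a := fun a => harg₂_of_ne hED'.symm hE'D'.symm a
  have hfv₃ : ∀ i, i ≠ u → C₃.fanout (.var i) = C.fanout (.var i) := by
    intro i hiu
    have h1 := C₂.fanout_removeGate_add D ε h0₂ (v := .var i) (fun h => by cases h)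
    have h2 : (univ.filter fun a : Fin 2 => C₂.arg D a = .var i).card = 0 := by
      rw [card_eq_zero, filter_eq_empty_iff]
      intro a _ h
      rw [hDwires] at h
      rcases fin2_eq_or_eq_rev aD a with e' | e'
      · rw [e', hcfg.arg_D] at h; cases h
      · rw [e', hIu] at h; cases h; exact hiu rfl
    change C₃.fanout (.var i) + _ = _ at h1
    rw [h2, hfv₂] at h1
    omega
  have hfu₃ : C₃.fanout (.var u) = 0 := by
    have h1 := C₂.fanout_removeGate_add D ε h0₂ (v := .var u) (fun h => by cases h)
    have h2 : 1 ≤ (univ.filter fun a : Fin 2 => C₂.arg D a = .var u).card :=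
      card_pos.mpr ⟨aD.rev, mem_filter.mpr ⟨mem_univ _, by rw [hDwires]; exact hIu⟩⟩
    change C₃.fanout (.var u) + _ = _ at h1
    rw [hfv₂, hu1] at h1
    omega
  have hfg₃ : ∀ k', ι k' ≠ G → C₃.fanout (.gate k') = C.fanout (.gate (ι k')) := by
    intro k' hkG
    have h1 := C₂.fanout_removeGate_add D ε h0₂ (v := .gate (ι k')) (fun h => hιD k' (Node.gate.inj h))
    have h2 : (univ.filter fun a : Fin 2 => C₂.arg D a = .gate (ι k')).card = 0 := by
      rw [card_eq_zero, filter_eq_empty_iff]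
      intro a _ h
      rw [hDwires] at h
      rcases fin2_eq_or_eq_rev aD a with e' | e'
      · rw [e', hcfg.arg_D] at h; cases h; exact hkG rfl
      · rw [e', hIu] at h; cases h
    have hskip : (Node.gate (ι k') : Node n C₂.m).skip D ε = .gate k' := Node.skip_gate_coe D ε k'
    rw [hskip] at h1
    change C₃.fanout (.gate k') + _ = _ at h1
    rw [h2, hfg₂ _ (hιD k')] at h1
    omega
  have hfG₃ : ∀ k', ι k' = G → C₃.fanout (.gate k') = 0 := by
    intro k' hkG
    have h1 := C₂.fanout_removeGate_add D ε h0₂ (v := .gate (ι k')) (fun h => hιD k' (Node.gate.inj h))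
    have h2 : 1 ≤ (univ.filter fun a : Fin 2 => C₂.arg D a = .gate (ι k')).card :=
      card_pos.mpr ⟨aD, mem_filter.mpr ⟨mem_univ _, by rw [hDwires, hkG]; exact hcfg.arg_D⟩⟩
    have hskip : (Node.gate (ι k') : Node n C₂.m).skip D ε = .gate k' := Node.skip_gate_coe D ε k'
    rw [hskip] at h1
    change C₃.fanout (.gate k') + _ = _ at h1
    rw [hfg₂ _ (hιD k')] at h1
    rw [hkG] at h1 h2
    rw [hcfg.fanout_G] at h1
    omega
  -- the source
  have hfree' : ∀ i, R'.Free i ↔ R.Free i ∧ i ≠ u := fun i => RdqSource.free_assignQuad_iff hu hup hx hxp hy hyp hcfg.x_ne_y hux huy i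
  have hprot' : ∀ i, R'.Protected i ↔ R.Protected i ∨ i = x ∨ i = y := fun i =>
    RdqSource.protected_assignQuad_iff hu hup hx hxp hy hyp hcfg.x_ne_y hux huy i
  have hq' : R'.quadCount = R.quadCount + 1 := RdqSource.quadCount_assignQuad hu hup hx hxp hy hyp hcfg.x_ne_y hux huy
  have hdim' : R'.dim + 1 = R.dim := RdqSource.dim_assignQuad hu hup hx hxp hy hyp hcfg.x_ne_y hux huy
  -- semantics: on the new source, `D` computes the constant `kE`
  have hval_u : ∀ v ∈ R'.Sol, finTwoEquiv (v u) = (((finTwoEquiv (v x) ^^ cx) && (finTwoEquiv (v y) ^^ cy)) ^^ c₃) := by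
    intro v hv
    rw [RdqSource.mem_sol_assignQuad_iff] at hv
    rw [hv.2]
    show finTwoEquiv ((v x + boolToZMod2 cx) * (v y + boolToZMod2 cy) + boolToZMod2 c₃) = _
    rw [finTwoEquiv_add, finTwoEquiv_mul, finTwoEquiv_add, finTwoEquiv_add, finTwoEquiv_boolToZMod2,
      finTwoEquiv_boolToZMod2, finTwoEquiv_boolToZMod2]
  have hGval : ∀ (xb : Fin n → Bool) (w : Fin C.m → Bool), C.GateEq xb w G →
      w G = (((xb x ^^ cx) && (xb y ^^ cy)) ^^ g₃) := by
    intro xb w hw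
    unfold GateEq at hw
    rw [hw, hopG]
    rcases fin2_eq_or_eq_rev 0 aX with e0 | e0
    · have hx0 : C.arg G 0 = .var x := by rw [← e0]; exact hcfg.arg_G_x
      have hy1 : C.arg G 1 = .var y := by rw [show (1 : Fin 2) = Fin.rev 0 from rfl, ← e0]; exact hcfg.arg_G_y
      rw [hx0, hy1]
      show (((xb x ^^ g₁) && (xb y ^^ g₂)) ^^ g₃) = (((xb x ^^ (if aX = 0 then g₁ else g₂)) && (xb y ^^ (if aX = 0 then g₂ else g₁))) ^^ g₃)
      rw [if_pos e0, if_pos e0]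
    · have e1 : aX = 1 := by rw [e0]; rfl
      have hx1 : C.arg G 1 = .var x := by rw [← e1]; exact hcfg.arg_G_x
      have hy0 : C.arg G 0 = .var y := by rw [show (0 : Fin 2) = Fin.rev 1 from rfl, ← e1]; exact hcfg.arg_G_y
      rw [hx1, hy0]
      show (((xb y ^^ g₁) && (xb x ^^ g₂)) ^^ g₃) = (((xb x ^^ (if aX = 0 then g₁ else g₂)) && (xb y ^^ (if aX = 0 then g₂ else g₁))) ^^ g₃)
      rw [if_neg (by rw [e1]; decide), if_neg (by rw [e1]; decide), Bool.and_comm]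
  have hDval : ∀ (xb : Fin n → Bool) (w : Fin C.m → Bool), C.GateEq xb w D → w D = ((w G ^^ xb u) ^^ dD) := by
    intro xb w hw
    unfold GateEq at hw
    rw [hw, hdD]
    rcases fin2_eq_or_eq_rev 0 aD with e0 | e0
    · have h0 : C.arg D 0 = .gate G := by rw [← e0]; exact hcfg.arg_D
      have h1 : C.arg D 1 = .var u := by rw [show (1 : Fin 2) = Fin.rev 0 from rfl, ← e0]; exact hIu
      rw [h0, h1]; rfl
    · have e1 : aD = 1 := by rw [e0]; rfl
      have h1 : C.arg D 1 = .gate G := by rw [← e1]; exact hcfg.arg_D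
      have h0 : C.arg D 0 = .var u := by rw [show (0 : Fin 2) = Fin.rev 1 from rfl, ← e1]; exact hIu
      rw [h0, h1]; show ((xb u ^^ w G) ^^ dD) = _; rw [Bool.xor_comm (xb u)]
  have hC₃ : C₃.ComputesRestr f R' := by
    refine ⟨fun i hi => ?_, fun v hv w₃ hw₃ => ?_⟩
    · by_cases hiu : i = u
      · rw [hiu]; exact hfu₃
      · rw [hfv₃ i hiu]
        exact hC.1 i fun h => hi ((hfree' i).mpr ⟨h, hiu⟩)
    · have hvR : v ∈ R.Sol := ((RdqSource.mem_sol_assignQuad_iff hu hup hx hxp hy hyp hcfg.x_ne_y hux huy v).mp hv).1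
      set xb := boolOfZMod2.symm v with hxb
      let w₂ := C₂.extendVals D ε w₃ (C₂.deletedVal D ε xb w₃)
      have hw₂ : C₂.Consistent xb w₂ := Consistent.extendVals ε h0₂ hw₃
      have hnv : ∀ (w : Fin C.m → Bool) (v' : Node n C.m), C₂.nodeVal xb w v' = C.nodeVal xb w v' := fun w v' => by
        cases v' <;> rfl
      have hothers : ∀ k, k ≠ E → k ≠ E' → C.GateEq xb w₂ k := by
        intro k h1 h2
        have := hw₂ k
        unfold GateEq at this ⊢
        rw [hop₂, harg₂_of_ne h1 h2, harg₂_of_ne h1 h2, hnv, hnv] at this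
        exact this
      have hwG := hGval xb w₂ (hothers G hEG.symm hE'G.symm)
      have hwD : w₂ D = kE := by
        rw [hDval xb w₂ (hothers D hED'.symm hE'D'.symm), hwG]
        have hu' : xb u = (((xb x ^^ cx) && (xb y ^^ cy)) ^^ c₃) := by
          have := hval_u v hv
          rw [hxb, Circuit.boolOfZMod2_symm_apply, Circuit.boolOfZMod2_symm_apply, Circuit.boolOfZMod2_symm_apply]
          exact this
        rw [hu']
        generalize ((xb x ^^ cx) && (xb y ^^ cy)) = p
        cases p <;> cases g₃ <;> cases dD <;> cases kE <;> rfl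
      have hCw : C.Consistent xb w₂ := by
        intro k
        by_cases hkE : k = E
        · rw [hkE]
          have := hw₂ E
          change w₂ E = C₂.op E (C₂.nodeVal xb w₂ (C₂.arg E 0)) (C₂.nodeVal xb w₂ (C₂.arg E 1)) at this
          change w₂ E = C.op E (C.nodeVal xb w₂ (C.arg E 0)) (C.nodeVal xb w₂ (C.arg E 1))
          rw [hop₂, hargE₂, hargE₂, hnv, hnv] at this
          rw [this]
          have key : ∀ a, C.nodeVal xb w₂ (argsE a) = C.nodeVal xb w₂ (C.arg E a) := by
            intro a
            show C.nodeVal xb w₂ (if a = aE then Node.const kE else C.arg E a) = _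
            by_cases ha : a = aE
            · rw [if_pos ha, ha, hED]; exact hwD.symm
            · rw [if_neg ha]
          rw [key, key]
        · by_cases hkE' : k = E'
          · rw [hkE']
            have := hw₂ E'
            change w₂ E' = C₂.op E' (C₂.nodeVal xb w₂ (C₂.arg E' 0)) (C₂.nodeVal xb w₂ (C₂.arg E' 1)) at this
            change w₂ E' = C.op E' (C.nodeVal xb w₂ (C.arg E' 0)) (C.nodeVal xb w₂ (C.arg E' 1))
            rw [hop₂, hargE'₂, hargE'₂, hargsE'eq, hargsE'eq, hnv, hnv] at this
            rw [this]
            have key : ∀ a, C.nodeVal xb w₂ (if a = aE' then Node.const kE else C.arg E' a) = C.nodeVal xb w₂ (C.arg E' a) := by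
              intro a
              by_cases ha : a = aE'
              · rw [if_pos ha, ha, hE'D]; exact hwD.symm
              · rw [if_neg ha]
            rw [key, key]
          · exact hothers k hkE hkE'
      have hout_val := hC.2 v hvR w₂ hCw
      have hout₂ : C₂.out ≠ .gate D := hDout
      show C₃.nodeVal xb w₃ (C₂.out.skip D ε) = f v
      rw [← C₂.nodeVal_extendVals D ε xb w₃ (C₂.deletedVal D ε xb w₃) hout₂, hnv]
      exact hout_val
  -- troubled gates of `C₃` were troubled, and `G` is no longer
  have htroub : ∀ k', C₃.Troubled k' → C.Troubled (ι k') ∧ ι k' ≠ G := by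
    intro k' hT
    have hkG : ι k' ≠ G := by
      intro h; have := hfG₃ k' h; have := hT.2.1; omega
    refine ⟨?_, hkG⟩
    obtain ⟨hand, hf1, v₁, v₂, hne, hrange, hv₁, hv₂⟩ := hT
    -- no constant wire, so both positions are in the "kept" case
    have hno : ∀ a, ¬ ((ι k' = E ∧ a = aE) ∨ (ι k' = E' ∧ a = aE')) := by
      intro a h
      have hc := hconst₃ k' a h
      have : C₃.arg k' a ∈ Set.range (C₃.arg k') := ⟨a, rfl⟩
      rw [hrange, hc] at this
      rcases this with h' | h' <;> cases h'
    have hv₁u : v₁ ≠ u := by intro h; rw [h, hfu₃] at hv₁; cases hv₁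
    have hv₂u : v₂ ≠ u := by intro h; rw [h, hfu₃] at hv₂; cases hv₂
    refine ⟨by rw [← hop₃]; exact hand, by rw [← hfg₃ k' hkG]; exact hf1, v₁, v₂, hne, ?_,
      by rw [← hfv₃ v₁ hv₁u]; exact hv₁, by rw [← hfv₃ v₂ hv₂u]; exact hv₂⟩
    ext nd
    constructor
    · rintro ⟨a, rfl⟩
      have hm : C₃.arg k' a ∈ Set.range (C₃.arg k') := ⟨a, rfl⟩
      rw [hrange] at hm
      rcases hm with hm | hm
      · rw [(hvar₃ k' a (hno a) v₁).mp hm]; exact Or.inl rfl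
      · rw [(hvar₃ k' a (hno a) v₂).mp hm]; exact Or.inr rfl
    · intro hm
      rcases hm with hm | hm
      · have : (Node.var v₁ : Node n C₃.m) ∈ Set.range (C₃.arg k') := by rw [hrange]; exact Or.inl rfl
        obtain ⟨a, ha⟩ := this
        exact ⟨a, by rw [hm]; exact (hvar₃ k' a (hno a) v₁).mp ha⟩
      · have : (Node.var v₂ : Node n C₃.m) ∈ Set.range (C₃.arg k') := by rw [hrange]; exact Or.inr rfl
        obtain ⟨a, ha⟩ := this
        exact ⟨a, by rw [hm]; exact (hvar₃ k' a (hno a) v₂).mp ha⟩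
  -- accounting
  have hm₃ : C₃.m + 1 = C.m := C₂.removeGate_m_add_one D ε
  have hT : ((univ.filter fun k' => C₃.Troubled k').card : ℝ) + 1 ≤ (univ.filter fun k => C.Troubled k).card := by
    have h1 : (univ.filter fun k' => C₃.Troubled k').card ≤ ((univ.filter fun k => C.Troubled k).erase G).card := by
      refine card_le_card_of_injOn ι (fun k' hk' => ?_) (fun a _ b _ h => hιinj h)
      rw [mem_coe, mem_filter] at hk'
      rw [mem_coe, mem_erase, mem_filter]
      exact ⟨(htroub k' hk'.2).2, mem_univ _, (htroub k' hk'.2).1⟩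
    have h2 := card_erase_add_one (mem_filter.mpr ⟨mem_univ _, hcfg.troubled⟩ : G ∈ univ.filter fun k => C.Troubled k)
    have : (univ.filter fun k' => C₃.Troubled k').card + 1 ≤ (univ.filter fun k => C.Troubled k).card := by omega
    exact_mod_cast this
  have huinf : u ∈ C.influential R := C.mem_influential_of_reads R hIu
  have hxinf : x ∈ C.influential R := C.mem_influential_of_reads R hcfg.arg_G_x
  have hyinf : y ∈ C.influential R := C.mem_influential_of_reads R hcfg.arg_G_y
  have hinf : ((C₃.influential R').card : ℝ) + 1 ≤ (C.influential R).card := by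
    have hsub : C₃.influential R' ⊆ (C.influential R).erase u := by
      intro i hi
      unfold influential at hi
      rw [mem_filter] at hi
      rw [mem_erase]
      rcases hi.2 with h | h
      · have hiu : i ≠ u := by intro e'; rw [e', hfu₃] at h; omega
        refine ⟨hiu, ?_⟩
        unfold influential; rw [mem_filter]; rw [hfv₃ i hiu] at h; exact ⟨mem_univ _, Or.inl h⟩
      · rw [hprot'] at h
        rcases h with h | h | h
        · exact ⟨fun e' => hup (e' ▸ h), by unfold influential; rw [mem_filter]; exact ⟨mem_univ _, Or.inr h⟩⟩
        · rw [h]; exact ⟨hux.symm, hxinf⟩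
        · rw [h]; exact ⟨huy.symm, hyinf⟩
    have h1 := card_le_card hsub
    have h2 := card_erase_add_one huinf
    have : (C₃.influential R').card + 1 ≤ (C.influential R).card := by omega
    exact_mod_cast this
  have hm' : (C₃.m : ℝ) + 1 = C.m := by exact_mod_cast hm₃
  have hq'' : (R'.quadCount : ℝ) = R.quadCount + 1 := by exact_mod_cast hq'
  have hμ : C₃.measure αφ αI αQ ∅ R' ≤ C.measure αφ αI αQ ∅ R - 1 - αI - αφ + αQ := by
    unfold measure potential troubledCount
    simp only [card_empty, Nat.cast_zero, sub_zero]
    rw [hq'']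
    nlinarith [mul_le_mul_of_nonneg_left hT hφ, mul_le_mul_of_nonneg_left hinf hI]
  exact ⟨C₃, R', ι, hF₃, hC₃, hdim', hm₃, hιinj, hιD, hιsurj, hconst₃, hvar₃, hgate₃, hop₃, hout₃, hfv₃, hfg₃, hfG₃, hfree',
    hprot', hq', htroub, hμ⟩

end Quad

end Semicircuit

end Literature.Computability.Complexity
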